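/-
Copyright: cell pub-balaban-gaps, seat ne8 (estimate NE7c), gen 15. Project licence.
-/
import Summits.QuantumFields.BalabanUV.T4Continuum.Spine.NE7b.CompactFibreProfileVolumeSUN

/-!
# Road (δ) on print's PROFILE (integrated-denominator) currency on `bonds → SU(N)`, ALL `N` (ne6's V35): at a live OUTER window the
# profile letter is FREE below ONE nesting clause `ρ ≤ ν₀·η`, and the creation-step price in print's profile shape has ONE value for the
# grid — only the large-field floor moves (`× λ₀²`) (row NE7c; junction J-18♭ = J-13 §4 for every `N`, Hilbert–Schmidt windows)

Cell `pub-balaban-gaps` (G2), seat ne8, estimate **NE7c** (`T4IndicatorShell.ShellWeightBound`; two-run artefact, NOT PRINTED in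
[Bałaban 1983–89], NOT PROVED).  Thirty-fifth proof-only file under `Spine/NE7c/`: seat ne6 GEN 15's census file V35
`Spine/NE7b/CompactFibreProfileVolumeSUN` (print's INTEGRATED shape [Balaban1989LargeFieldII] p. 356 (1.2) ∕ (1.10) on the product Haar
fibre `bonds → SU(N)`, all `N`: `pi_sball_mono`, `neg_log_profileVolume_le`, `neg_log_quadProfileVolume_le`, and the junction
`creationPrice_SUN_profile_valued`) consumed BY NAME at road (δ)'s live letters; imports that file only.  Nothing of Bałaban's is named; no
`def`; 0 `sorry`.  Companion of file 34 `LiveFactorCreationPriceSUN` (the WINDOW-VOLUME currency for every `N`).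

THE QUESTION (seat census `HOME/ne/NE7c.md` §22, row 49 (ii) = row 47 (ii) FOR EVERY `N`).  File 27 §4 read the `SU(2)` profile letter
(V27, trace windows) at a live OUTER window: FREE below the nesting clause `σ ≤ ν₀η`.  V35 states the letter and the creation-step price
in print's profile shape for every `N` with Hilbert–Schmidt windows: the profile bound `q ≤ q₀` on an INNER window `Π_b SB_ρ` (print: the
Gaussian width `ρ ≈ √2·g_k`), the denominator `∫_{Π SB_η} e^{−q} dκ` over the OUTER window — a LOWER-bound use of the window, which road
(δ) lowers to `Π_b SB_{νη}`, `ν ∈ [ν₀, 1]`, together with the large-field radius `δ′ ↦ s·δ′`, `s ∈ [λ₀, 1]`.  Does anything move?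

WHAT IS PROVED ([folklore]; V35's theorems BY NAME at `(νη, sδ′)` plus two lines of real arithmetic):
* §1 **`neg_log_profileVolume_SUN_le_live`** — below the ONE nesting clause `ρ ≤ ν₀·η` (the lowered outer window still contains the
  inner one) and with `e^{−q}` integrable on the dead outer window: `−log ∫_{Π SB_{νη}} e^{−q} dκ ≤ q₀ + b` with the SAME `q₀` and the SAME
  inner-window letter `b ≥ −log κ(Π SB_ρ)` for EVERY `ν` — rate AND constant assignment-free: NO loss;
  `neg_log_quadProfileVolume_SUN_le_live` — the quadratic trace profile `(2σ)⁻¹Σ_b Re tr(1 − v_b)` (the model of `½g_k⁻²|B′|²`):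
  `#bonds·ρ²∕(4σ) + b`, no `ν` — print's «`−½d(𝔤)log g_k⁻² + log σ₀`» per degree of freedom survives road (δ) VERBATIM, every `N`.
* §2 **`creationPrice_SUN_profile_valued_live`** — V35's junction with the event at the LIVE radius `sδ′` (`0 ≤ λ₀ ≤ s`), `G ≥ 1` and the
  profile domination read on the LIVE centred outer window, the profile bound and the letter on the inner window below the nesting clause:
  `∫ F·w·e^{−I} ≤ exp(−λ₀²·(λ∕2)δ′² + q₀ + b)·(∫F dκ)·∫ G·w·e^{−I}` — the SAME for every assignment `(s, ν)`: only the floor moves (`× λ₀²`).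

CENSUS (row 49 (ii), NEW; `HOME/ne/NE7c.md` §22): in print's INTEGRATED (profile) currency the (n)-carrier's creation step has NO volume
loss under road (δ) for every `N` below the ONE nesting clause `ρ ≤ ν₀·η` (row 47 (ii) for all `N`; by value `ρ = √2·g_k` against an outer
half-width `η = C₀g_k·p(g_k)`-shaped, met once `p(g_k) ≥ √2∕(C₀ν₀)` — one largeness row, one `g⋆(ν₀)`); the large-field floor scales by
`λ₀²` (class C1, row 1).  Identical under (δ-1) and (δ-global…).  MILD ∕ FREE.  BY-NAME EFFECT ON THE WALL: none (junction ∕ census file).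

NOT HERE (honest): which profile `q` and which windows Bałaban's step carries ((A3) ∕ (A1c), NC-NE7b-α UNRULED); node O; NE7c.  VERDICT
WORD UNCHANGED: WORK-bound behind node O; INSTANCE 0∕1.  NE7c ∕ NE7b NOT PRINTED ∕ NOT PROVED; spine 0∕9; one finite T⁴ — NOT ℝ⁴, NOT
infinite volume, NOT the mass gap, NOT Clay.
HONEST DEPENDENCY (cell): continuum YM on T⁴ ⇐ BetaPertH ∧ nine spine estimates (0∕9 proved); BetaPertH ⇐ (D1) ∧ (D4) ∧ CAP+tail.
-/

set_option autoImplicit false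

noncomputable section

open MeasureTheory Real Finset
open scoped Matrix.Norms.Frobenius
open Literature.MathematicalPhysics.QuantumFieldTheory (haarProbability)
open Summit.QuantumFields.BalabanUV.T4Continuum.NE7b.CompactFibreProfileVolumeSUN
  (pi_sball_mono neg_log_profileVolume_le neg_log_quadProfileVolume_le creationPrice_SUN_profile_valued)

namespace Summit.QuantumFields.BalabanUV.T4Continuum.Spine.NE7c.LiveFactorProfileSUN

/-! ## §1 The profile letter at a live OUTER window, ALL `N`: FREE below one nesting clause -/

section Profile

variable {N : ℕ} {B : Type*} [Fintype B]

/-- **THE PROFILE LETTER AT A LIVE OUTER WINDOW IS FREE, ALL `N`** (V35's `neg_log_profileVolume_le` BY NAME).  The profile bound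
`q ≤ q₀` lives on the INNER window `Π_b SB_ρ` (print: the Gaussian width), the integral runs over the OUTER window, which road (δ) lowers to
`Π_b SB_{νη}`, `ν ∈ [ν₀, 1]`.  Below the ONE nesting clause `ρ ≤ ν₀·η` and with `e^{−q}` integrable on the dead window `Π_b SB_η`:
`−log ∫_{Π SB_{νη}} e^{−q} dκ ≤ q₀ + b` with the SAME `q₀` and the SAME inner-window letter `b ≥ −log κ(Π SB_ρ)` for EVERY `ν` — rate AND
constant assignment-free: NO loss in print's integrated currency. [folklore] -/
theorem neg_log_profileVolume_SUN_le_live {ρ η q₀ b ν ν₀ : ℝ} (hη : 0 ≤ η) (hν : ν₀ ≤ ν) (hν1 : ν ≤ 1) (hnest : ρ ≤ ν₀ * η)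
    (hpos : 0 < ((Measure.pi fun _ : B => haarProbability (Matrix.specialUnitaryGroup (Fin N) ℂ))
      (Set.univ.pi fun _ : B => {V : Matrix.specialUnitaryGroup (Fin N) ℂ | ‖(V : Matrix (Fin N) (Fin N) ℂ) - 1‖ ≤ ρ})).toReal)
    (hvol : -Real.log ((Measure.pi fun _ : B => haarProbability (Matrix.specialUnitaryGroup (Fin N) ℂ))
      (Set.univ.pi fun _ : B => {V : Matrix.specialUnitaryGroup (Fin N) ℂ | ‖(V : Matrix (Fin N) (Fin N) ℂ) - 1‖ ≤ ρ})).toReal ≤ b)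
    (q : (B → Matrix.specialUnitaryGroup (Fin N) ℂ) → ℝ)
    (hq : ∀ v ∈ (Set.univ.pi fun _ : B => {V : Matrix.specialUnitaryGroup (Fin N) ℂ | ‖(V : Matrix (Fin N) (Fin N) ℂ) - 1‖ ≤ ρ}),
      q v ≤ q₀)
    (hint : IntegrableOn (fun v => exp (-q v))
      (Set.univ.pi fun _ : B => {V : Matrix.specialUnitaryGroup (Fin N) ℂ | ‖(V : Matrix (Fin N) (Fin N) ℂ) - 1‖ ≤ η})
      (Measure.pi fun _ : B => haarProbability (Matrix.specialUnitaryGroup (Fin N) ℂ))) :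
    -Real.log (∫ v in (Set.univ.pi fun _ : B =>
          {V : Matrix.specialUnitaryGroup (Fin N) ℂ | ‖(V : Matrix (Fin N) (Fin N) ℂ) - 1‖ ≤ ν * η}),
        exp (-q v) ∂(Measure.pi fun _ : B => haarProbability (Matrix.specialUnitaryGroup (Fin N) ℂ))) ≤
      q₀ + b := by
  have hρνη : ρ ≤ ν * η := hnest.trans (mul_le_mul_of_nonneg_right hν hη)
  have hνηη : ν * η ≤ η := mul_le_of_le_one_left hη hν1
  exact neg_log_profileVolume_le hρνη hpos hvol q hq (hint.mono_set (pi_sball_mono hνηη))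

/-- **THE QUADRATIC TRACE PROFILE AT A LIVE OUTER WINDOW, ALL `N`** (V35's `neg_log_quadProfileVolume_le` BY NAME at `νη`): for `σ > 0`,
`η ≥ 0`, `ρ ≤ ν₀·η`, `ν₀ ≤ ν` and any inner-window letter `b`,
`−log ∫_{Π SB_{νη}} exp(−(2σ)⁻¹Σ_b Re tr(1 − v_b)) dκ ≤ #bonds·ρ²∕(4σ) + b` — the bound does not mention `ν`: print's
«`−½d(𝔤)log g_k⁻² + log σ₀`» per degree of freedom, rate AND constant, survives road (δ) VERBATIM in the integrated currency, every `N`.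
[folklore] -/
theorem neg_log_quadProfileVolume_SUN_le_live {σ ρ η b ν ν₀ : ℝ} (hσ0 : 0 < σ) (hη : 0 ≤ η) (hν : ν₀ ≤ ν) (hnest : ρ ≤ ν₀ * η)
    (hpos : 0 < ((Measure.pi fun _ : B => haarProbability (Matrix.specialUnitaryGroup (Fin N) ℂ))
      (Set.univ.pi fun _ : B => {V : Matrix.specialUnitaryGroup (Fin N) ℂ | ‖(V : Matrix (Fin N) (Fin N) ℂ) - 1‖ ≤ ρ})).toReal)
    (hvol : -Real.log ((Measure.pi fun _ : B => haarProbability (Matrix.specialUnitaryGroup (Fin N) ℂ))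
      (Set.univ.pi fun _ : B => {V : Matrix.specialUnitaryGroup (Fin N) ℂ | ‖(V : Matrix (Fin N) (Fin N) ℂ) - 1‖ ≤ ρ})).toReal ≤ b) :
    -Real.log (∫ v in (Set.univ.pi fun _ : B =>
          {V : Matrix.specialUnitaryGroup (Fin N) ℂ | ‖(V : Matrix (Fin N) (Fin N) ℂ) - 1‖ ≤ ν * η}),
        exp (-((2 * σ)⁻¹ * ∑ b, (Matrix.trace (1 - ((v b : Matrix.specialUnitaryGroup (Fin N) ℂ) : Matrix (Fin N) (Fin N) ℂ))).re))
          ∂(Measure.pi fun _ : B => haarProbability (Matrix.specialUnitaryGroup (Fin N) ℂ))) ≤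
      (Fintype.card B : ℝ) * ρ ^ 2 / (4 * σ) + b :=
  neg_log_quadProfileVolume_le hσ0 (hnest.trans (mul_le_mul_of_nonneg_right hν hη)) hpos hvol

/-! ## §2 The creation-step price in print's PROFILE shape at live letters, ALL `N`: ONE price for the grid -/

variable {Y : Type*} [MeasurableSpace Y] (μ : Measure Y) [SFinite μ]

/-- **THE CREATION-STEP PRICE IN PRINT's PROFILE SHAPE AT LIVE LETTERS, ALL `N` — ONE PRICE FOR THE GRID** (V35's
`creationPrice_SUN_profile_valued` BY NAME at `(νη, sδ′)`).  The event at the LIVE radius `s·δ′` (`0 ≤ λ₀ ≤ s`); `G ≥ 1` and the profile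
domination `I ≤ m₀ + q` on the LIVE centred outer window `U₀(y)·Π_b SB_{νη}` (`0 ≤ η`, `ν ∈ [ν₀, 1]`); the profile bound `q ≤ q₀` and the letter
`b` on the INNER window `Π_b SB_ρ` below the nesting clause `ρ ≤ ν₀·η`; `e^{−q}` integrable on the dead outer window.  Then
`∫ F·w·e^{−I} ≤ exp(−λ₀²·(λ∕2)δ′² + q₀ + b)·(∫F dκ)·∫ G·w·e^{−I}` — the SAME for every assignment `(s, ν)`: in the integrated currency only the
floor moves (`× λ₀²`). [folklore] -/
theorem creationPrice_SUN_profile_valued_live {ρ η q₀ b ν ν₀ s lam0 : ℝ} (hη : 0 ≤ η) (hν : ν₀ ≤ ν) (hν1 : ν ≤ 1)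
    (hnest : ρ ≤ ν₀ * η) (h0 : 0 ≤ lam0) (hs : lam0 ≤ s)
    (hpos : 0 < ((Measure.pi fun _ : B => haarProbability (Matrix.specialUnitaryGroup (Fin N) ℂ))
      (Set.univ.pi fun _ : B => {V : Matrix.specialUnitaryGroup (Fin N) ℂ | ‖(V : Matrix (Fin N) (Fin N) ℂ) - 1‖ ≤ ρ})).toReal)
    (hvol : -Real.log ((Measure.pi fun _ : B => haarProbability (Matrix.specialUnitaryGroup (Fin N) ℂ))
      (Set.univ.pi fun _ : B => {V : Matrix.specialUnitaryGroup (Fin N) ℂ | ‖(V : Matrix (Fin N) (Fin N) ℂ) - 1‖ ≤ ρ})).toReal ≤ b)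
    (F G : (B → Matrix.specialUnitaryGroup (Fin N) ℂ) → ℝ) (w : Y → ℝ)
    (I : (B → Matrix.specialUnitaryGroup (Fin N) ℂ) × Y → ℝ) (m₀ : Y → ℝ) (U₀ : Y → (B → Matrix.specialUnitaryGroup (Fin N) ℂ))
    (q : (B → Matrix.specialUnitaryGroup (Fin N) ℂ) → ℝ) {lam δ' : ℝ}
    (hF0 : ∀ x, 0 ≤ F x) (hG0 : ∀ x, 0 ≤ G x) (hw0 : ∀ y, 0 ≤ w y) (hlam : 0 ≤ lam) (hδ : 0 ≤ δ')
    (hq : ∀ v ∈ (Set.univ.pi fun _ : B => {V : Matrix.specialUnitaryGroup (Fin N) ℂ | ‖(V : Matrix (Fin N) (Fin N) ℂ) - 1‖ ≤ ρ}),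
      q v ≤ q₀)
    (hint : IntegrableOn (fun v => exp (-q v))
      (Set.univ.pi fun _ : B => {V : Matrix.specialUnitaryGroup (Fin N) ℂ | ‖(V : Matrix (Fin N) (Fin N) ℂ) - 1‖ ≤ η})
      (Measure.pi fun _ : B => haarProbability (Matrix.specialUnitaryGroup (Fin N) ℂ)))
    (hF : ∀ x y, F x ≠ 0 → w y ≠ 0 →
      ∃ b : B, s * δ' ≤ ‖(((U₀ y b)⁻¹ * x b : Matrix.specialUnitaryGroup (Fin N) ℂ) : Matrix (Fin N) (Fin N) ℂ) - 1‖)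
    (hconv : ∀ x y, F x ≠ 0 → w y ≠ 0 →
      m₀ y + lam / 2 * ∑ b, ‖(((U₀ y b)⁻¹ * x b : Matrix.specialUnitaryGroup (Fin N) ℂ) : Matrix (Fin N) (Fin N) ℂ) - 1‖ ^ 2 ≤ I (x, y))
    (hGwin : ∀ y v, w y ≠ 0 →
      v ∈ (Set.univ.pi fun _ : B => {V : Matrix.specialUnitaryGroup (Fin N) ℂ | ‖(V : Matrix (Fin N) (Fin N) ℂ) - 1‖ ≤ ν * η}) →
      1 ≤ G (U₀ y * v))
    (hIprof : ∀ y v, w y ≠ 0 →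
      v ∈ (Set.univ.pi fun _ : B => {V : Matrix.specialUnitaryGroup (Fin N) ℂ | ‖(V : Matrix (Fin N) (Fin N) ℂ) - 1‖ ≤ ν * η}) →
      I (U₀ y * v, y) ≤ m₀ y + q v)
    (hFi : Integrable F (Measure.pi fun _ : B => haarProbability (Matrix.specialUnitaryGroup (Fin N) ℂ)))
    (hGI : ∀ y, w y ≠ 0 →
      Integrable (fun x => G x * exp (-I (x, y))) (Measure.pi fun _ : B => haarProbability (Matrix.specialUnitaryGroup (Fin N) ℂ)))
    (hA' : Integrable (fun z : (B → Matrix.specialUnitaryGroup (Fin N) ℂ) × Y => F z.1 * w z.2 * exp (-I z))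
      ((Measure.pi fun _ : B => haarProbability (Matrix.specialUnitaryGroup (Fin N) ℂ)).prod μ))
    (hB' : Integrable (fun z : (B → Matrix.specialUnitaryGroup (Fin N) ℂ) × Y => G z.1 * w z.2 * exp (-I z))
      ((Measure.pi fun _ : B => haarProbability (Matrix.specialUnitaryGroup (Fin N) ℂ)).prod μ)) :
    ∫ z, F z.1 * w z.2 * exp (-I z) ∂((Measure.pi fun _ : B => haarProbability (Matrix.specialUnitaryGroup (Fin N) ℂ)).prod μ) ≤
      exp (-(lam0 ^ 2 * (lam / 2 * δ' ^ 2)) + q₀ + b) *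
        (∫ x, F x ∂(Measure.pi fun _ : B => haarProbability (Matrix.specialUnitaryGroup (Fin N) ℂ))) *
        ∫ z, G z.1 * w z.2 * exp (-I z) ∂((Measure.pi fun _ : B => haarProbability (Matrix.specialUnitaryGroup (Fin N) ℂ)).prod μ) := by
  have hρνη : ρ ≤ ν * η := hnest.trans (mul_le_mul_of_nonneg_right hν hη)
  have hνηη : ν * η ≤ η := mul_le_of_le_one_left hη hν1
  have hsδ : 0 ≤ s * δ' := mul_nonneg (h0.trans hs) hδ
  -- V35's junction at the live letters `(νη, sδ′)`
  have key := creationPrice_SUN_profile_valued μ hρνη hpos hvol F G w I m₀ U₀ q hF0 hG0 hw0 hlam hsδ hq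
    (hint.mono_set (pi_sball_mono hνηη)) hF hconv hGwin hIprof hFi hGI hA' hB'
  -- the two nonnegative factors
  have hFint : 0 ≤ ∫ x, F x ∂(Measure.pi fun _ : B => haarProbability (Matrix.specialUnitaryGroup (Fin N) ℂ)) :=
    integral_nonneg hF0
  have hint0 : 0 ≤ ∫ z, G z.1 * w z.2 * exp (-I z)
      ∂((Measure.pi fun _ : B => haarProbability (Matrix.specialUnitaryGroup (Fin N) ℂ)).prod μ) :=
    integral_nonneg fun z => mul_nonneg (mul_nonneg (hG0 _) (hw0 _)) (exp_pos _).le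
  -- the floor at the live radius dominates `λ₀²` times the dead floor
  have hsq : lam0 ^ 2 ≤ s ^ 2 := pow_le_pow_left₀ h0 hs 2
  have hfloor : lam0 ^ 2 * (lam / 2 * δ' ^ 2) ≤ lam / 2 * (s * δ') ^ 2 := by
    have hnn : 0 ≤ lam / 2 * δ' ^ 2 := by positivity
    calc lam0 ^ 2 * (lam / 2 * δ' ^ 2) ≤ s ^ 2 * (lam / 2 * δ' ^ 2) := mul_le_mul_of_nonneg_right hsq hnn
      _ = lam / 2 * (s * δ') ^ 2 := by ring
  have hexp : exp (-(lam / 2 * (s * δ') ^ 2) + q₀ + b) ≤ exp (-(lam0 ^ 2 * (lam / 2 * δ' ^ 2)) + q₀ + b) :=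
    Real.exp_le_exp.2 (by linarith)
  refine key.trans ?_
  have := mul_le_mul_of_nonneg_right (mul_le_mul_of_nonneg_right hexp hFint) hint0
  simpa [mul_assoc] using this

end Profile

/-! ## §3 Sanity -/

/-- The nesting clause by value in print's letters (`ρ = √2·g`, outer half-width `η = C₀·g·p`): `√2·g ≤ ν₀·(C₀·g·p)` as soon as
`√2 ≤ ν₀·C₀·p` — one largeness row on `p`, uniform in `g > 0`. -/
example {g C₀ p ν₀ : ℝ} (hg : 0 < g) (h : Real.sqrt 2 ≤ ν₀ * C₀ * p) : Real.sqrt 2 * g ≤ ν₀ * (C₀ * g * p) := by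
  have := mul_le_mul_of_nonneg_right h hg.le
  nlinarith

end Summit.QuantumFields.BalabanUV.T4Continuum.Spine.NE7c.LiveFactorProfileSUN

end
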